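import Summits.ResolutionOfSingularities.ResolutionOfSingularities.Theorems.PurelyInseparableDim4ResConeFourWeights
import Summits.ResolutionOfSingularities.ResolutionOfSingularities.Theorems.PurelyInseparableDim4ResConeBInfFrames
import HarnessLib
import HarnessLib.Audit.Tags

/-!
# Purely inseparable four-folds — FRAME BOOKKEEPING for the D∞ heavy line at `(p, d) = (5, 4)`: the residual factorisations
# the Φ-line step laws consume on TAIL-D data, and the shape of a `(2)`-state (cell `res-dim4-pi`, K2(p) lane, slice C `(5,4)`;
# CARD I-1-9 «THE HEAVY LINE»; kernel hand res-dim4-p-7 g5)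

[OURS · counted 0 · cell `res-dim4-pi` · K2(p) lane (holder res-dim4-p-12 g4); the `(5,4)` twin of res-dim4-p-9 g4's
`…ResConeBInfFrames` §§1–2 (p702450), for the heavy-line stubs K₄ / L₄ of CARD I-1-9 (res-dim4-idea-1 g8); kernel hand
res-dim4-p-7 g5.]  Nothing here proves K2(5), TAIL-D, `NoIsolatedTrap 5 5` or resolution of singularities in dimension ≥ 4 /
characteristic `p` — NOT proved.  AI kernel work, weaker than expert review.

On TAIL-D data (isolated witnessed `Step0 5` chain, `x^{r₀} ∣ F₀`, off the floor, shade `4` from `k₀`; holder's W₄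
`…ResConeFourWeights`):
* §1 **`dInf_factorisation`** — `(c k).F = x^{r_k} · G_k` with `G_k := (c k).F.divMonomial (c k).r`, `ord₀ G_k = 4`,
  `5 ≤ |r_k| + 4`, `x^{r_k} ∣ F_k` (the `hF/hd/hp` binders of the Φ-line step laws at `d = 4`);
  **`dInf_step_factorisation`** — `(step 5 univ (j k) (b k) (c k)).F = x^{(r_k|_{b_k = 0}).update (j k) (|r_k| + 4 − 5)} · G_{k+1}`
  with `4 ≤ ord₀ G_{k+1}` (the `hF′/hd′` binders);
* §2 **`dInf_two_state`** — at a `(2)`-state (`|r_k| = 2`, heavy letter `r_k h = 2`): `r_k = 2·e_h` (every other weight is `0`),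
  `ord₀ F_k = 6`, and (W₄ `dInf_pattern`) the step is KEEP-H: chart letter `j k ≠ h`, `b k h = 0`, `r_{k+1} h = 2`,
  `r_{k+1} (j k) = 1`; `dInf_two_state_newborn` — the newborn exponent `|r_k| + 4 − 5 = 1` and `5 − 1 = 4 = d` (so the cleaning
  correction of the KEEP-H step lies in `(x_{j k}^4)`: order `≥ d` for free, the input replacing `r_h + d = p` in the heavy KEEP law).
Def-free; `p = 5` throughout.
[cite: Hauser2010, §F (setting f = x^p + y^r g)] [cite: CossartJannsenSaito2020, Thm. 3.14]
bears_on: LADDER-RESOLUTION:D157-DOOR2 (res-dim4-pi · K2(p) · slice C (5,4) D∞ heavy line, frames).  Supports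
stmt-ResolutionOfSingularities-16155 (helper).
-/

set_option linter.dupNamespace false -- mandated namespace of this single-conjunct summit

noncomputable section

namespace Summit.ResolutionOfSingularities.ResolutionOfSingularities.Theorems.PIDim4

namespace ResCone

open MvPolynomial Finset IsLocalRing
open Literature.AlgebraicGeometry.Resolution
open Literature.AlgebraicGeometry.Resolution.CentreBlowup
open Literature.AlgebraicGeometry.Resolution.Hauser2010
open Literature.AlgebraicGeometry.Resolution.HauserPerlega2019
open Literature.AlgebraicGeometry.Resolution.WeightedOrder

variable {K : Type} [Field K]

/-! ## 1. The residual factorisation at a shade-4 state -/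

section Factorisation

variable [DecidableEq K]

/-- **`x^r · G` with `ord₀ G = 4` at every state of a shade-4 tail.**  On TAIL-D data (isolated witnessed `Step0 5` chain,
`x^{r₀} ∣ F₀`, off the floor, shade `4` from `k₀`), for `k ≥ k₀`: `(c k).F = x^{r_k} · G_k` with
`G_k = (c k).F.divMonomial (c k).r`, `ord₀ G_k = 4`, `5 ≤ |r_k| + 4`, and `x^{r_k} ∣ F_k`.
[OURS · bookkeeping] [cite: Hauser2010, §F (setting f = x^p + y^r g)] -/
theorem dInf_factorisation {c : ℕ → State K} {j : ℕ → Fin 4} {b : ℕ → Fin 4 → K}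
    (hc : ∀ k, IsIsolated 5 (c k).F ∧ Step0 5 (c k) (c (k + 1))) (hw : FreeTail.IsWitnessedChain 5 c j b)
    (hr0 : ∀ e ∈ (c 0).F.support, (c 0).r ≤ e) (hfloor : ∀ k, ordZero (c k).F ≠ 5) {k₀ : ℕ}
    (hshade : ∀ k, k₀ ≤ k → (c k).shade = ((4 : ℕ) : ℕ∞)) {k : ℕ} (hk : k₀ ≤ k) :
    (c k).F = monomial (c k).r 1 * (c k).F.divMonomial (c k).r ∧
      ordZero ((c k).F.divMonomial (c k).r) = (4 : ℕ) ∧ 5 ≤ (c k).r.degree + 4 ∧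
      (∀ e ∈ (c k).F.support, (c k).r ≤ e) := by
  obtain ⟨hord, -, -, hfl, -⟩ := four_weights_laws hc hw hr0 hfloor hshade
  have hrk := IsolatedBand.isolated_chain_forall_le hc hr0 k
  have hF : (c k).F = monomial (c k).r 1 * (c k).F.divMonomial (c k).r := eq_monomial_mul_divMonomial hrk
  refine ⟨hF, ?_, by have := hfl k hk; omega, hrk⟩
  have h1 := hord k hk
  rw [hF, PhiLine.ordZero_monomial_one_mul, Nat.cast_add] at h1
  exact (add_right_inj_of_ne_top (ENat.coe_ne_top _)).mp h1

/-- **The step factorisation** (`hF′/hd′` of the Φ-line step laws at `d = 4`): for `k ≥ k₀` on TAIL-D data,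
`(step 5 univ (j k) (b k) (c k)).F = x^{(r_k|_{b_k = 0}).update (j k) (|r_k| + 4 − 5)} · G_{k+1}` with
`G_{k+1} = (c (k+1)).F.divMonomial (c (k+1)).r` and `4 ≤ ord₀ G_{k+1}`. [OURS · bookkeeping]
[cite: Hauser2010, §F (setting f = x^p + y^r g)] -/
theorem dInf_step_factorisation {c : ℕ → State K} {j : ℕ → Fin 4} {b : ℕ → Fin 4 → K}
    (hc : ∀ k, IsIsolated 5 (c k).F ∧ Step0 5 (c k) (c (k + 1))) (hw : FreeTail.IsWitnessedChain 5 c j b)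
    (hr0 : ∀ e ∈ (c 0).F.support, (c 0).r ≤ e) (hfloor : ∀ k, ordZero (c k).F ≠ 5) {k₀ : ℕ}
    (hshade : ∀ k, k₀ ≤ k → (c k).shade = ((4 : ℕ) : ℕ∞)) {k : ℕ} (hk : k₀ ≤ k) :
    (CentreBlowup.step 5 Finset.univ (j k) (b k) (c k)).F =
        monomial ((((c k).r.filter fun i => b k i = 0)).update (j k) ((c k).r.degree + 4 - 5)) 1 *
          (c (k + 1)).F.divMonomial (c (k + 1)).r ∧
      ((4 : ℕ) : ℕ∞) ≤ ordZero ((c (k + 1)).F.divMonomial (c (k + 1)).r) := by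
  obtain ⟨-, hlaw, -, hfl, -⟩ := four_weights_laws hc hw hr0 hfloor hshade
  obtain ⟨hF₁, hd₁, -, -⟩ := dInf_factorisation hc hw hr0 hfloor hshade (k := k + 1) (by omega)
  have hstep : c (k + 1) = CentreBlowup.step 5 Finset.univ (j k) (b k) (c k) := (hw k).2.2.2.2
  refine ⟨?_, hd₁.symm.le⟩
  have hr₁ : (c (k + 1)).r = (((c k).r.filter fun i => b k i = 0)).update (j k) ((c k).r.degree + 4 - 5) := by
    rw [hlaw k hk]
    congr 1
  rw [← hstep, ← hr₁]
  exact hF₁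

end Factorisation

/-! ## 2. The shape of a `(2)`-state and of its KEEP-H step -/

section TwoState

variable [DecidableEq K]

/-- A weight vector of total weight `2` with a letter of weight `2` is `2·e_h`: every other letter weighs `0`. [folklore] -/
theorem apply_eq_zero_of_degree_two {r : Fin 4 →₀ ℕ} (h2 : r.degree = 2) {h : Fin 4} (hrh : r h = 2) {i : Fin 4}
    (hi : i ≠ h) : r i = 0 := by
  have hsum : r.degree = ∑ l, r l := by
    rw [Finsupp.degree_eq_sum]
  rw [hsum] at h2
  have hle : r h + r i ≤ ∑ l, r l := by
    rw [← Finset.sum_pair hi.symm]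
    exact Finset.sum_le_sum_of_subset_of_nonneg (Finset.subset_univ _) fun _ _ _ => Nat.zero_le _
  omega

/-- **THE `(2)`-STATE OF THE D∞ CLASS AND ITS KEEP-H STEP.**  On TAIL-D data, at `k ≥ k₀` with `|r_k| = 2` and a heavy letter
`r_k h = 2`: every other weight vanishes, `ord₀ F_k = 6`, and the step is KEEP-H — chart letter `j k ≠ h`, no translation
along `h` (`b k h = 0`), the child keeps `r_{k+1} h = 2` and its newborn letter weighs `r_{k+1} (j k) = 1` (W₄ `dInf_pattern`).
[OURS · bookkeeping] [cite: CossartJannsenSaito2020, Thm. 3.14] -/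
theorem dInf_two_state {c : ℕ → State K} {j : ℕ → Fin 4} {b : ℕ → Fin 4 → K}
    (hc : ∀ k, IsIsolated 5 (c k).F ∧ Step0 5 (c k) (c (k + 1))) (hw : FreeTail.IsWitnessedChain 5 c j b)
    (hr0 : ∀ e ∈ (c 0).F.support, (c 0).r ≤ e) (hfloor : ∀ k, ordZero (c k).F ≠ 5) {k₀ : ℕ}
    (hshade : ∀ k, k₀ ≤ k → (c k).shade = ((4 : ℕ) : ℕ∞)) {k : ℕ} (hk : k₀ ≤ k) (h2 : (c k).r.degree = 2)
    {h : Fin 4} (hrh : (c k).r h = 2) :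
    (∀ i, i ≠ h → (c k).r i = 0) ∧ ordZero (c k).F = ((6 : ℕ) : ℕ∞) ∧
      j k ≠ h ∧ b k h = 0 ∧ (c (k + 1)).r h = 2 ∧ (c (k + 1)).r (j k) = 1 := by
  obtain ⟨hord, -, -, -, -⟩ := four_weights_laws hc hw hr0 hfloor hshade
  obtain ⟨hjh, hbh, hr₁h, hr₁j⟩ := (dInf_pattern hc hw hr0 hfloor hshade hk hrh).1 h2
  refine ⟨fun i hi => apply_eq_zero_of_degree_two h2 hrh hi, ?_, hjh, hbh, hr₁h, hr₁j⟩
  rw [hord k hk, h2]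

/-- The newborn exponent of the KEEP-H step at a `(2)`-state is `|r_k| + 4 − 5 = 1`, prime to `5`, with `5 − 1 = 4 = d`: the
cleaning correction `R ∈ (x_{j k}^{5 − 1})` of (K-Φ2) II has order `≥ d` whatever the heavy letter's exponent.
[OURS · bookkeeping] [folklore] -/
theorem dInf_two_state_newborn {r : Fin 4 →₀ ℕ} (h2 : r.degree = 2) {h m : Fin 4} (hhm : h ≠ m) {b : Fin 4 → K}
    (hbh : b h = 0) (hrh : r h = 2) :
    ((r.filter fun i => b i = 0).update m (r.degree + 4 - 5)) m = 1 ∧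
      ((r.filter fun i => b i = 0).update m (r.degree + 4 - 5)) h = 2 ∧
      ¬ 5 ∣ ((r.filter fun i => b i = 0).update m (r.degree + 4 - 5)) m ∧
      ¬ 5 ∣ ((r.filter fun i => b i = 0).update m (r.degree + 4 - 5)) h := by
  have hm : ((r.filter fun i => b i = 0).update m (r.degree + 4 - 5)) m = 1 := by
    rw [Finsupp.coe_update, Function.update_self, h2]
  have hh : ((r.filter fun i => b i = 0).update m (r.degree + 4 - 5)) h = 2 := by
    rw [Finsupp.coe_update, Function.update_of_ne hhm, Finsupp.filter_apply_pos (fun i => b i = 0) r hbh, hrh]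
  refine ⟨hm, hh, ?_, ?_⟩
  · rw [hm]; decide
  · rw [hh]; decide

end TwoState

end ResCone

end Summit.ResolutionOfSingularities.ResolutionOfSingularities.Theorems.PIDim4

end
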